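import Summits.Ventures.GridStability.Models.SMIBOrbit
import HarnessLib

/-!
# GridStability/Models/SMIBWellEntry — well entry along a flow line, and two real-analysis helpers

Cell `gridfusion` (LADDER-GRIDFUSION G1-cct, SMIB threshold question), seat gridfusion-model-1,
`plan/PARTITION.md` §0 row `Models/`.  Small lemmas feeding `SMIBClearingThreshold.lean`:

* `roa_of_wellEntry` — a flow line of the classical SMIB model whose angle stays in the window
  `(−π − δˢ, π − δˢ)` on `[0, s_g]` and whose energy at `s_g` is `< V_cr` keeps its angle in the
  window for all times and tends to `(δˢ, 0)` (lit-6's `energyWell_subset_regionOfAttraction`,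
  p465446, applied to the tail and transported by the group law of the flow)
  [cite: SauerPai1998, §9.6.2 (9.34)–(9.39)];
* `exists_speed_lt` — a planar motion with `δ̇ = ω` whose angle stays below a bound on `[0, ∞)` has
  speed `< ε` at some time (else `δ(s) ≥ δ(0) + εs`) [folklore];
* `le_of_lt_on_Ico` — a continuous function `< A` on `[0, s_p)` (`s_p > 0`) is `≤ A` at `s_p`
  [folklore].

MODELLED: classical SMIB (MV-1). No sentence here says a machine is stable.
-/

noncomputable section

open Real Set Filter Topology

namespace Summit.Ventures.GridStability.Models.SMIBOrbit

variable {p : Literature.MathematicalPhysics.PowerSystems.SMIB}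

/-- **Well entry along a flow line ⇒ return.**  If the flow line from `y` keeps its angle in the
window on `[0, s_g]` and has energy `< V_cr` at time `s_g`, then it keeps its angle in the window for
all `s ≥ 0` and tends to `(δˢ, 0)` (lit-6's energy-well theorem applied to the tail, transported by
the group law of the flow). [cite: SauerPai1998, §9.6.2 (9.34)–(9.39)] -/
theorem roa_of_wellEntry (hM : 0 < p.M) (hD : 0 < p.D) (hPmax : 0 < p.Pmax) {δs : ℝ}
    (heq : p.IsEquilibriumAngle δs) (h0 : 0 ≤ δs) (h1 : δs < π / 2) {y : ℝ × ℝ} {sg : ℝ}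
    (hsg : 0 ≤ sg) (hwin : ∀ s ∈ Icc 0 sg, (flow p hM y s).1 ∈ Ioo (-π - δs) (π - δs))
    (hV : p.energy δs (flow p hM y sg) < p.criticalEnergy δs) :
    (∀ s, 0 ≤ s → (flow p hM y s).1 ∈ Ioo (-π - δs) (π - δs)) ∧
      Tendsto (flow p hM y) atTop (𝓝 (δs, 0)) := by
  have key := p.energyWell_subset_regionOfAttraction hM hD hPmax heq h0 h1 hV
    (y := flow p hM y sg) (hwin sg ⟨hsg, le_rfl⟩) le_rfl
  obtain ⟨hstay, hlim⟩ := key.2 (flow p hM (flow p hM y sg)) (flow_zero hM _) (flow_isSolution hM _)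
  have hfun : flow p hM y = fun s => flow p hM (flow p hM y sg) (s + -sg) := by
    funext s
    have h := flow_add hM y sg (s + -sg)
    rw [show sg + (s + -sg) = s by ring] at h
    exact h
  constructor
  · intro s hs
    rcases le_or_gt s sg with hle | hgt
    · exact hwin s ⟨hs, hle⟩
    · rw [hfun]
      exact (hstay (s + -sg) (by linarith)).1
  · rw [hfun]
    exact hlim.comp (tendsto_atTop_add_const_right _ _ tendsto_id)

/-- A planar motion `Ψ` with `δ̇ = ω` (everywhere) whose angle stays below `A` on `[0, ∞)` has
speed `< ε` at some time `s ≥ 0`, for every `ε > 0` (otherwise `δ(s) − εs` is non-decreasing and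
`δ` exceeds `A`). [folklore] -/
theorem exists_speed_lt {Ψ : ℝ → ℝ × ℝ} (hΨ1' : ∀ x, HasDerivAt (fun s => (Ψ s).1) (Ψ x).2 x)
    {ε A : ℝ} (hε : 0 < ε) (hlt : ∀ s, 0 ≤ s → (Ψ s).1 < A) : ∃ s, 0 ≤ s ∧ (Ψ s).2 < ε := by
  by_contra h
  push Not at h
  have hgd : ∀ x, HasDerivAt (fun s => (Ψ s).1 - ε * s) ((Ψ x).2 - ε * 1) x := fun x =>
    (hΨ1' x).fun_sub ((hasDerivAt_id' x).const_mul ε)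
  have hg : MonotoneOn (fun s => (Ψ s).1 - ε * s) (Ici 0) := by
    refine monotoneOn_of_deriv_nonneg (convex_Ici 0)
      (fun x _ => (hgd x).continuousAt.continuousWithinAt)
      (fun x _ => (hgd x).differentiableAt.differentiableWithinAt) fun x hx => ?_
    rw [interior_Ici] at hx
    rw [(hgd x).deriv]
    have := h x (le_of_lt hx)
    linarith
  have hA : (Ψ 0).1 < A := hlt 0 le_rfl
  set sstar : ℝ := (A - (Ψ 0).1) / ε + 1 with hsstar
  have hsstar0 : 0 ≤ sstar := by
    rw [hsstar]
    have : 0 ≤ (A - (Ψ 0).1) / ε := div_nonneg (by linarith) hε.le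
    linarith
  have h1 : (Ψ 0).1 - ε * 0 ≤ (Ψ sstar).1 - ε * sstar :=
    hg self_mem_Ici (hsstar0 : sstar ∈ Ici 0) hsstar0
  rw [mul_zero, sub_zero] at h1
  have h2 : ε * sstar = A - (Ψ 0).1 + ε := by
    rw [hsstar]; field_simp
  have h3 := hlt sstar hsstar0
  linarith

/-- A continuous `f` with `f s < A` for all `s ∈ [0, s_p)`, `s_p > 0`, satisfies `f s_p ≤ A`.
[folklore] -/
theorem le_of_lt_on_Ico {f : ℝ → ℝ} (hf : Continuous f) {A sp : ℝ} (hsp : 0 < sp)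
    (hlt : ∀ s ∈ Ico 0 sp, f s < A) : f sp ≤ A := by
  by_contra h
  push Not at h
  obtain ⟨l, u, ⟨hl, hu⟩, hsub⟩ := mem_nhds_iff_exists_Ioo_subset.1
    (continuousAt_const.eventually_lt hf.continuousAt h)
  set s' : ℝ := (max l 0 + sp) / 2 with hs'
  have hml : max l 0 < sp := max_lt hl hsp
  have hs1 : s' < sp := by rw [hs']; linarith
  have hs2 : max l 0 < s' := by rw [hs']; linarith
  have hs3 : l < s' := lt_of_le_of_lt (le_max_left _ _) hs2
  have hs4 : 0 ≤ s' := (le_max_right _ _).trans hs2.le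
  have h1 : A < f s' := hsub ⟨hs3, hs1.trans hu⟩
  exact absurd (hlt s' ⟨hs4, hs1⟩) (not_lt.2 h1.le)

end Summit.Ventures.GridStability.Models.SMIBOrbit

end
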